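import Summits.KontsevichZagierPeriods.Zeta5Search.Barrier.ConeGammaGammaModulusLocal

/-!
# ζ(5) search — BARRIER: AT A REGULAR DIRECTION THE SIGN OF `Λ` DECIDES WHETHER `a` IS A LOCAL MAXIMISER OF `γ` ON `Dir` — `Λ < 0 ⇒ IsLocalMax γ a`, `Λ > 0 ⇒` not

HONEST FRAMING (cell `pub-zeta5`): systematic search; no irrationality claim unless kernel-certified. MODEL objects
under Brown–Zudilin's (28)+(30) accounting ([BZ22] = arXiv:2210.03391; (28) observed, not proved): the rate function
`γ = (C₁ − C₀)/(C₁ + δ₂₈ − Φ)` of `ConeGammaRates` near a rational direction. Nothing here is a statement about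
`ζ(5)`, any `γ` OF RECORD, the cone's supremum (C2 = `BarrierC2`, OPEN) or the value / sign of the cusp slope or of
the modulus at a named direction — at the cell's four named directions (record/41, flag/60, argmax-120, t*/480) ASCENT
RAYS EXIST (DATA of P2 g11/g34–g36, relay 268), so NO named direction is asserted to be a local maximiser of anything
— there «Regular» and «open box» are kernel facts on cert-2's `r = 1/200` boxes (`regular_box_*_200`, NOT imported
here, named only as the reason the hypotheses hold on those boxes), `Q > 0` stays a hypothesis and `Λ > 0` is DATA, so
the local-maximum half below applies to NONE of them; every «local maximum / maximiser» below is a GERM statement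
(`IsLocalMax`) whose quantitative radius is Lemma B's coherence radius ∩ P2 g23's stability radius — NOT S-E's covering
ball; the lemma S-E / S-E′ stays CONJECTURED; records in print UNMOVED. Prover P2 g38, file (3) of three of the item «`γ`
INHERITS THE LOCAL MAXIMUM» (P2 g37's successor menu (a)), theorems only.

THE POINT. File (2) (`ConeGammaGammaModulusLocal`) decided `γ`'s local maximality ON THE SLICE `{η₀ = 0}` at a Regular
open-box direction with `Q = C₁ + δ₂₈ − Φ > 0` by the sign of P2 g36's modulus `Λ(a,T)`. But `γ` is a function of the
DIRECTION only (`gamma_smul`: `γ(t•a) = γ(a)`, `t > 0`), so the slice is no restriction: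
* **`eventually_gamma_lt_or_radial_of_strict_of_regular`** — `Λ < 0 ⇒` every `b` near `a` in `Dir = ℝ⁸` has
  `γ(b) < γ(a)` UNLESS `b` lies on the ray `ℝ₊·a` (the radial retraction `b ↦ (s₀(a)/s₀(b))•s(b) − s(a)` is
  continuous, vanishes at `a`, lands in the slice, and does not change `γ`);
* **`isLocalMax_gamma_of_strict_of_regular`** — hence **`IsLocalMax γ a`**: THE HONEST FORM OF S-E′'s CLAUSE «rational
  directions are cusp-type local maxima of `Φ` (and hence of `γ`, since `C₀`, `C₁`, `δ₂₈` are Lipschitz there and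
  `∂γ/∂Φ > 0`)» (`BARRIER-PLAN.md` §2b) — a Regular open-box direction with `Q > 0` and `Λ(a,T) < 0` for some period
  `T` IS a local maximiser (strict modulo the ray) of the MODEL rate function on the whole parameter space — a germ
  statement, quantitative radius = Lemma B's coherence radius ∩ g23's stability radius, NOT S-E's covering ball; the
  Lipschitz data are P2 g23's `regular_stable` and the tree's `abs_delta28_sub_le_sParam`, `∂γ/∂Φ > 0` is
  `C0_lt_C1_of_regular`, the cusp is file (1)'s uniform expansion;
* **`isLocalMax_gamma_dichotomy_of_regular`**, **`modulus_sign_decides_isLocalMax_gamma_of_regular`** — with P2 g23's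
  `not_isLocalMax_gamma_of_cuspSlope_pos`: `Λ(a,T) < 0 ⇒ IsLocalMax γ a`, `Λ(a,T) > 0 ⇒ ¬ IsLocalMax γ a`;
* `modulus_nonpos_of_isLocalMax_gamma_of_regular` — and conversely a local maximiser (germ sense) has `Λ(a,T) ≤ 0` for
  EVERY period `T` (g23's `cuspSlope_nonpos_of_isLocalMax` read through P2 g36's
  `forall_cuspSlope_nonpos_iff_modulus_nonpos`).
So at a Regular open-box direction with `Q > 0`: `Λ < 0 ⇒ local maximiser ⇒ Λ ≤ 0`, and `Λ > 0 ⇒` not (all in the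
germ sense above — coherence ∩ stability radius, not S-E's ball) — two implications each way, NO iff: the flat case
`Λ = 0` is NOT decided by the first order.
NOT here (honest): which lattice directions have `Λ < 0` — none of the four named ones (ascent rays, DATA: by g23 they
would NOT be local maximisers in the germ sense), and S-E′'s «`B(t₀) > 0` at the lattice maximisers» is NOT addressed;
`IsLocalMax` is a germ statement — the quantitative radius behind it is Lemma B's coherence radius ∩ P2 g23's stability
radius (file (1)), NOT S-E's covering radius `1/(2λ₀)`, and S-E stays CONJECTURED; the loss loci and closed-box
faces are not covered; no value of `Λ`, `σ`, `Q`, `γ` at a named direction enters a statement; nothing about C2 (a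
GLOBAL statement about the cone's supremum) or `ζ(5)`.
-/

noncomputable section

open Set MeasureTheory Filter
open scoped Topology

namespace Summit.KontsevichZagierPeriods.Zeta5Search.Barrier.ConeGamma

/-! ### `γ` depends on the direction only: from the slice to the whole parameter space -/

/-- **`Λ < 0 ⇒` EVERY NEARBY DIRECTION OFF THE RAY HAS SMALLER `γ`.** At a Regular open-box direction `a` with `Q > 0`
and a period `T`: if `σ < 0` in every non-radial direction (`⇔ Λ(a,T) < 0`), then for all `b ∈ Dir = ℝ⁸` near `a`,
EITHER `γ(b) < γ(a)` OR `b = t•a` for some `t > 0` (and then `γ(b) = γ(a)`, `gamma_smul`). (The radial retraction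
`b ↦ (s₀(a)/s₀(b))•s(b) − s(a)` is continuous, vanishes at `a`, lands in the slice `η₀ = 0`, and
`γ(aOfS((s₀(a)/s₀(b))•s(b))) = γ(b)` by degree-0 homogeneity.) An `∀ᶠ` (germ) statement: the quantitative radius
behind it is Lemma B's coherence radius ∩ P2 g23's stability radius — NOT S-E's covering ball (S-E / S-E′ CONJECTURED);
no named direction is asserted to satisfy the hypothesis; the flat case is not decided. -/
theorem eventually_gamma_lt_or_radial_of_strict_of_regular {a : Dir}
    (hopen : ∀ j : Fin 7, 0 < sParam a j.succ ∧ sParam a j.succ < sParam a 0) (hreg : Regular a)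
    (hQ : 0 < C1 a + delta28 a - phi30 a) {T : ℝ} (hT : 0 < T)
    (hper : ∀ k : Fin 28, ∃ z : ℤ, T * h28 a k = z)
    (hstrict : ∀ δ : Fin 8 → ℝ, (∃ k l, phiForm δ k / h28 a k ≠ phiForm δ l / h28 a l) → cuspSlope a T δ < 0) :
    ∀ᶠ b in 𝓝 a, gamma b < gamma a ∨ ∃ t : ℝ, 0 < t ∧ b = t • a := by
  have hs0 : 0 < sParam a 0 := sParam_zero_pos (h28_pos_of_openBox hopen)
  obtain ⟨r, hr, h⟩ := gamma_lt_on_slice_of_strict_of_regular hopen hreg hQ hT hper hstrict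
  -- the radial retraction onto the slice is continuous at `a` and vanishes there
  have hc0 : ContinuousAt (fun b : Dir => sParam b 0) a :=
    ((continuous_apply 0).comp continuous_sParam).continuousAt
  have hR : ContinuousAt (fun b : Dir => (sParam a 0 / sParam b 0) • sParam b - sParam a) a :=
    ((continuousAt_const.div hc0 hs0.ne').smul continuous_sParam.continuousAt).sub continuousAt_const
  have hR0 : (sParam a 0 / sParam a 0) • sParam a - sParam a = 0 := by
    rw [div_self hs0.ne', one_smul, sub_self]
  have hRt : Tendsto (fun b : Dir => (sParam a 0 / sParam b 0) • sParam b - sParam a) (𝓝 a) (𝓝 0) := by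
    have := hR.tendsto; rwa [hR0] at this
  have hsmall : ∀ᶠ b in 𝓝 a, dist ((sParam a 0 / sParam b 0) • sParam b - sParam a) 0 < r / 2 :=
    Metric.tendsto_nhds.mp hRt (r / 2) (by linarith)
  have hb0 : ∀ᶠ b in 𝓝 a, 0 < sParam b 0 := hc0.eventually (eventually_gt_nhds hs0)
  filter_upwards [hsmall, hb0] with b hb hb0'
  rw [dist_zero_right] at hb
  obtain ⟨η, hη⟩ : ∃ η : Fin 8 → ℝ, η = (sParam a 0 / sParam b 0) • sParam b - sParam a := ⟨_, rfl⟩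
  rw [← hη] at hb
  have ht : 0 < sParam a 0 / sParam b 0 := div_pos hs0 hb0'
  have hη0 : η 0 = 0 := by
    rw [hη, Pi.sub_apply, Pi.smul_apply, smul_eq_mul, div_mul_cancel₀ _ hb0'.ne', sub_self]
  have hsum : sParam a + η = (sParam a 0 / sParam b 0) • sParam b := by rw [hη]; abel
  have hab : aOfS (sParam a + η) = (sParam a 0 / sParam b 0) • b := by
    rw [hsum, aOfS_smul, aOfS_sParam]
  have hYr : shiftSize η ≤ r := by linarith [shiftSize_le_two_mul_norm η]
  rcases (shiftSize_nonneg η).eq_or_lt with hY | hY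
  · -- `Y(η) = 0`: `η = 0`, so `b` is on the ray of `a`
    right
    have hz : η = 0 := eq_zero_of_forall_phiForm_eq_zero fun k =>
      abs_nonpos_iff.mp (hY ▸ abs_phiForm_le_shiftSize η k)
    have e2 : (sParam a 0 / sParam b 0) • b = a := by
      rw [← hab, hz, add_zero, aOfS_sParam]
    refine ⟨sParam b 0 / sParam a 0, div_pos hb0' hs0, ?_⟩
    have hone : sParam b 0 / sParam a 0 * (sParam a 0 / sParam b 0) = 1 := by
      field_simp
    calc b = (sParam b 0 / sParam a 0 * (sParam a 0 / sParam b 0)) • b := by rw [hone, one_smul]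
      _ = (sParam b 0 / sParam a 0) • a := by rw [← smul_smul, e2]
  · left
    have := h η hη0 hY hYr
    rwa [hab, gamma_smul ht] at this

/-- **`Λ < 0 ⇒ IsLocalMax γ a` ON THE WHOLE PARAMETER SPACE** — the honest form of S-E′'s clause «(and hence of `γ`, since
`C₀`, `C₁`, `δ₂₈` are Lipschitz there and `∂γ/∂Φ > 0)» (`BARRIER-PLAN.md` §2b): at a Regular open-box direction `a`
with `Q = C₁ + δ₂₈ − Φ > 0` and a period `T`, if `cuspSlope a T δ < 0` for every non-radial `δ` (`⇔ Λ(a,T) < 0`), then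
`a` is a local maximiser of the MODEL rate function `γ` on `Dir = ℝ⁸` (indeed a strict one modulo the ray `ℝ₊·a`,
`eventually_gamma_lt_or_radial_of_strict_of_regular`), where `IsLocalMax` here is a GERM statement whose quantitative
radius is Lemma B's coherence radius ∩ P2 g23's stability radius — NOT S-E's covering ball (S-E / S-E′ CONJECTURED).
The Lipschitz data are P2 g23's `regular_stable` and the tree's `abs_delta28_sub_le_sParam`, `∂γ/∂Φ > 0` is
`C0_lt_C1_of_regular`. HONEST: no named direction satisfies the hypothesis as far as the cell knows (at record/41,
flag/60, argmax-120, t*/480 ascent rays exist — DATA — so by P2 g23's `not_isLocalMax_gamma_of_cuspSlope_pos` they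
would NOT be local maximisers in this germ sense); S-E′'s «`B(t₀) > 0` at the lattice maximisers» is not addressed;
the flat case `Λ = 0` is not decided; nothing about C2 or `ζ(5)`. -/
theorem isLocalMax_gamma_of_strict_of_regular {a : Dir}
    (hopen : ∀ j : Fin 7, 0 < sParam a j.succ ∧ sParam a j.succ < sParam a 0) (hreg : Regular a)
    (hQ : 0 < C1 a + delta28 a - phi30 a) {T : ℝ} (hT : 0 < T)
    (hper : ∀ k : Fin 28, ∃ z : ℤ, T * h28 a k = z)
    (hstrict : ∀ δ : Fin 8 → ℝ, (∃ k l, phiForm δ k / h28 a k ≠ phiForm δ l / h28 a l) → cuspSlope a T δ < 0) :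
    IsLocalMax gamma a := by
  show ∀ᶠ b in 𝓝 a, gamma b ≤ gamma a
  filter_upwards [eventually_gamma_lt_or_radial_of_strict_of_regular hopen hreg hQ hT hper hstrict] with b hb
  rcases hb with hb | ⟨t, ht, rfl⟩
  · exact hb.le
  · rw [gamma_smul ht]

/-- **THE DICHOTOMY ON `Dir`.** At a Regular open-box direction `a` with `Q > 0` and a period `T` of the 28 forms: (1) `σ
< 0` in every non-radial direction (`⇔ Λ(a,T) < 0`) `⇒ IsLocalMax γ a`; (2) `σ(δ) > 0` for SOME `δ` (`⇔ Λ(a,T) > 0`)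
`⇒ ¬ IsLocalMax γ a` (P2 g23's `not_isLocalMax_gamma_of_cuspSlope_pos`); in both halves `IsLocalMax` here is a GERM
statement whose quantitative radius is Lemma B's coherence radius ∩ P2 g23's stability radius — NOT S-E's covering
ball (S-E / S-E′ CONJECTURED). Two implications, NO iff: the flat case `Λ = 0` is NOT decided by the first order.
Which case a given lattice direction is in is NOT asserted. -/
theorem isLocalMax_gamma_dichotomy_of_regular {a : Dir}
    (hopen : ∀ j : Fin 7, 0 < sParam a j.succ ∧ sParam a j.succ < sParam a 0) (hreg : Regular a)
    (hQ : 0 < C1 a + delta28 a - phi30 a) {T : ℝ} (hT : 0 < T)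
    (hper : ∀ k : Fin 28, ∃ z : ℤ, T * h28 a k = z) :
    ((∀ δ : Fin 8 → ℝ, (∃ k l, phiForm δ k / h28 a k ≠ phiForm δ l / h28 a l) → cuspSlope a T δ < 0) →
      IsLocalMax gamma a) ∧
    ((∃ δ : Fin 8 → ℝ, 0 < cuspSlope a T δ) → ¬ IsLocalMax gamma a) :=
  ⟨fun hstrict => isLocalMax_gamma_of_strict_of_regular hopen hreg hQ hT hper hstrict,
    fun ⟨_, hδ⟩ => not_isLocalMax_gamma_of_cuspSlope_pos hopen hT hper hQ hreg hδ⟩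

/-- **THE SIGN OF THE MODULUS DECIDES** (the same with `Λ` written out): at a Regular open-box direction with `Q > 0` and
a period `T`, for any `x` with two distinct rates carrying the modulus bound (the modulus ray of `exists_modulus_ray`,
`σ(x) = Λ(a,T)`): `σ(x) < 0 ⇒ IsLocalMax γ a` and `σ(x) > 0 ⇒ ¬ IsLocalMax γ a` (local maximiser in the germ sense:
`IsLocalMax` here is a GERM statement whose quantitative radius is Lemma B's coherence radius ∩ P2 g23's stability
radius — NOT S-E's covering ball (S-E / S-E′ CONJECTURED)). Two implications; `σ(x) = 0` is not decided; no value of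
`Λ` at a named direction is asserted. -/
theorem modulus_sign_decides_isLocalMax_gamma_of_regular {a : Dir}
    (hopen : ∀ j : Fin 7, 0 < sParam a j.succ ∧ sParam a j.succ < sParam a 0) (hreg : Regular a)
    (hQ : 0 < C1 a + delta28 a - phi30 a) {T : ℝ} (hT : 0 < T)
    (hper : ∀ k : Fin 28, ∃ z : ℤ, T * h28 a k = z) {x : Fin 8 → ℝ}
    (hxne : ∃ k l, phiForm x k / h28 a k ≠ phiForm x l / h28 a l)
    (hmod : ∀ δ : Fin 8 → ℝ, ∀ m M : Fin 28, (∀ k, phiForm δ m / h28 a m ≤ phiForm δ k / h28 a k ∧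
        phiForm δ k / h28 a k ≤ phiForm δ M / h28 a M) →
      cuspSlope a T δ ≤ cuspSlope a T x * (phiForm δ M / h28 a M - phiForm δ m / h28 a m)) :
    (cuspSlope a T x < 0 → IsLocalMax gamma a) ∧ (0 < cuspSlope a T x → ¬ IsLocalMax gamma a) :=
  ⟨fun hneg => isLocalMax_gamma_of_strict_of_regular hopen hreg hQ hT hper
      ((forall_cuspSlope_neg_iff_modulus_neg hxne hmod).mpr hneg),
    fun hxpos => not_isLocalMax_gamma_of_cuspSlope_pos hopen hT hper hQ hreg hxpos⟩

/-- **A LOCAL MAXIMISER HAS `Λ ≤ 0` FOR EVERY PERIOD** (the converse direction, P2 g23's `cuspSlope_nonpos_of_isLocalMax`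
read through P2 g36's modulus): at a Regular open-box direction with `Q > 0` that is a local maximiser of `γ` on `Dir`
(`IsLocalMax`, a germ statement — no radius, in particular not S-E's covering ball; S-E CONJECTURED), every `x` carrying
the modulus bound of a period `T` has `σ(x) ≤ 0`, i.e. `Λ(a,T) ≤ 0`. With
`modulus_sign_decides_isLocalMax_gamma_of_regular`: `Λ < 0 ⇒` local maximiser `⇒ Λ ≤ 0` — the flat case is the gap. -/
theorem modulus_nonpos_of_isLocalMax_gamma_of_regular {a : Dir}
    (hopen : ∀ j : Fin 7, 0 < sParam a j.succ ∧ sParam a j.succ < sParam a 0) (hreg : Regular a)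
    (hQ : 0 < C1 a + delta28 a - phi30 a) {T : ℝ} (hT : 0 < T)
    (hper : ∀ k : Fin 28, ∃ z : ℤ, T * h28 a k = z) {x : Fin 8 → ℝ}
    (hmod : ∀ δ : Fin 8 → ℝ, ∀ m M : Fin 28, (∀ k, phiForm δ m / h28 a m ≤ phiForm δ k / h28 a k ∧
        phiForm δ k / h28 a k ≤ phiForm δ M / h28 a M) →
      cuspSlope a T δ ≤ cuspSlope a T x * (phiForm δ M / h28 a M - phiForm δ m / h28 a m))
    (hmax : IsLocalMax gamma a) : cuspSlope a T x ≤ 0 :=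
  (forall_cuspSlope_nonpos_iff_modulus_nonpos hmod).mp
    fun δ => cuspSlope_nonpos_of_isLocalMax hopen hT hper δ hQ hreg hmax

end Summit.KontsevichZagierPeriods.Zeta5Search.Barrier.ConeGamma

end
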